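import Literature.IUT.HodgeTheaters.ThetaHodgeTheatersRemarksA
import Literature.IUT.HodgeTheaters.BiratUnitsNonVacuity
import Literature.IUT.HodgeTheaters.KappaSolAgreement
import Literature.AnabelianGeometry.AbsoluteAnabelian.NFSlimKummerProofs
import Literature.AlgebraicGeometry.Frobenioids.PadicFrobenioidMonoidData
import Literature.AlgebraicGeometry.Frobenioids.PadicFrobenioidBadLocalKit
import Literature.AlgebraicGeometry.Frobenioids.PadicFrobenioidMonogenicP
import HarnessLib

/-!
# [IUTchI] §3 Remarks 3.1.7 (iv), 3.2.2, 3.2.3 (ii): INSTANCE FORMS of three frozen fact-list schemata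
# at arithmetic models of the tree (number fields / MLFs; `p`-adic Frobenioids)

S. Mochizuki, *Inter-universal Teichmüller theory I*, RIMS manuscript (May 2020), §3: Remark 3.1.7 (iv)
pp. 68–69 («`Gal(L̄_C/L_C(κ-sol))` is center-free»), Remark 3.2.2 p. 74 («there exists a positive integer
`N` such that `N·Φ_{C⊢_v}` is absolutely primitive»), Remark 3.2.3 (ii) p. 75 («`ψ` induces an injective
homomorphism `𝒪^×(T_A^÷) ↪ 𝒪^×(B^÷)` [cf. [FrdI], Proposition 1.11, (iv)]»)
[cite: Mochizuki2012, IUTchI Rmk 3.1.7 (iv) p.68]; the arithmetic inputs are [AbsAnab] Thm. 1.1.1 (ii)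
(slimness of `G_F`, `G_k`) [cite: MochizukiAbsAnab2004, Thm 1.1.1 (ii) p.6] and [FrdII] Example 1.1 (ii)
(`p`-adic Frobenioids, absolutely primitive divisor monoids) [cite: MochizukiFrdII2008, Ex 1.1 (ii) p.8].

PROOF-ONLY companion (abc-iut cell, seat abc-iut-f-194, F = FACT-PROVING WAVE tranche 194; no `def`,
`instance` or `structure`).  The three rows are typed in the tree as `Prop`-valued PREDICATES on abstract
data — plan/FACT-LIST.md F-1392 `KappaSol.CenterFree` (`ThetaHodgeTheatersRemarksA.lean`), F-1314
`NearlyAbsolutelyPrimitive`, F-0751 `InjectiveAlongLinear` (`ThetaHodgeTheatersRemarksA2.lean`) — whose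
universal closures are REFUTED in `HodgeTheatersRemarksVocabularyClosures.lean` /
`FactListL5ClosureRefutations.lean` (R5: schema, admissible at named instances only).  This file proves the
INSTANCE FORMS at the arithmetic models the tree already CONSTRUCTS, unconditionally:

* **F-1392** `KappaSol.CenterFree K Ω M` (`Z(Gal(Ω/M)) = 1`): from slimness (`centerFree_of_isSlimGroup`:
  a slim `Gal(Ω/K)` has center-free open subgroups `Gal(Ω/M)`), hence for `K` a NUMBER FIELD or an MLF
  (finite over `ℚ_p`), `Ω = K̄` and every finite subextension `M` — by the tree's UNCONDITIONAL
  `galoisNF_slim_holds` / `galoisMLF_slim_holds` ([AbsAnab] Thm 1.1.1 (ii), Kummer-theoretic proofs).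
  (The intended `M = L_C(κ-sol)`, an infinite extension of a function field over a number field, rests on
  [NodNon] Thm. C and is NOT claimed here.)
* **F-1314** `NearlyAbsolutelyPrimitive Φ R` at THE INTENDED MODEL: the monogenic `p_v`-adic Frobenioid
  datum `C_v^⊢` of the tree (`PadicFrd.BadLocalKit.datum`, `Φ_{C_v^⊢} = ℕ·log(q′)` over a `K_v`-relative
  base of `p`-adic local fields), with `Φ A :=` the image of `Φ_{C_v^⊢}(A)` in `Φ₀(A)^gp` and
  `R A := ℤ·ord(ℚ_p^×)` (`Datum.ordQpSubgroup`): ONE positive `N` with `N·Φ ⊆ ℤ·ord(ℚ_p^×)` at every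
  object (`nearlyAbsolutelyPrimitive_badLocalKit`) — the printed «as is easily verified»: `v(q′)^n = v(p)^m`
  in one `p`-adic field of the base (`exists_pow_valuation_eq_zpow_le`), transported to `K_v` and to every
  fibre along the valuative embeddings; equivalently `Φ_{C_v^⊢}` is absolutely primitive for `Λ = ℚ`
  (`mem_lambdaSpanQ_of_nearlyAbsolutelyPrimitive`).  At a good place (`c = p`, `Datum.prim`) `N = 1`.
* **F-0751** `InjectiveAlongLinear U` at every `p`-adic Frobenioid datum `d` (model Frobenioid of [FrdI]
  Thm. 5.2 with the BiratUnits model data of `BiratUnitsNonVacuity.lean`): the pull-backs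
  `B(A) → B(A')` of `B = K^× ×_{Φ₀^gp} Φ^gp` are injective (`PadicFrd.Datum.map_B_injective`), so the
  conditional `model_injectiveAlongLinear_of_injective` is DISCHARGED for `C_v^⊢`, for the perfection hull and
  for `C₀` (indeed along every morphism).  The tempered Frobenioid `F̲_v` itself is not a model Frobenioid and
  is not covered.

HONEST FRAMING: classical instances of typed predicates; `typed ≠ proved` for the series; nothing here bears
on, or takes a side on, [IUTchIII] Cor. 3.12; a fact-list row is an assumption label, not an endorsement.
-/

noncomputable section

namespace Literature.IUT.HodgeTheaters

open CategoryTheory Opposite Function ValuativeRel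
open Literature.AlgebraicGeometry.Frobenioids
open Literature.AnabelianGeometry.AbsoluteAnabelian

universe v u

/-! ## F-1392 `KappaSol.CenterFree` ([IUTchI] Rmk 3.1.7 (iv) pp. 68–69): center-free from slim -/

namespace KappaSol

/-- If the centraliser of `Gal(Ω/M)` in `Gal(Ω/K)` is trivial, then `Gal(Ω/M)` is center-free
(`KappaSol.CenterFree K Ω M`). [cite: Mochizuki2012, IUTchI Rmk 3.1.7 (iv) p.69] -/
theorem centerFree_of_centralizer_eq_bot {K Ω : Type*} [Field K] [Field Ω] [Algebra K Ω]
    (M : IntermediateField K Ω)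
    (h : Subgroup.centralizer (M.fixingSubgroup : Set (Ω ≃ₐ[K] Ω)) = ⊥) : CenterFree K Ω M := by
  unfold CenterFree
  rw [eq_bot_iff]
  intro σ hσ
  rw [Subgroup.mem_bot]
  have hmem : (σ : Ω ≃ₐ[K] Ω) ∈ Subgroup.centralizer (M.fixingSubgroup : Set (Ω ≃ₐ[K] Ω)) := by
    rw [Subgroup.mem_centralizer_iff]
    intro τ hτ
    exact congrArg Subtype.val (Subgroup.mem_center_iff.mp hσ ⟨τ, hτ⟩)
  rw [h, Subgroup.mem_bot] at hmem
  exact Subtype.ext hmem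

/-- **Slim ⇒ center-free on open subgroups** (the mechanism of the printed deduction, [IUTchI] Rmk 3.1.7
(iv) p. 69 / [AbsAnab] §0): if `Gal(Ω/K)` is slim (Krull topology) and `Gal(Ω/M)` is open, then
`KappaSol.CenterFree K Ω M`. [cite: Mochizuki2012, IUTchI Rmk 3.1.7 (iv) p.69] -/
theorem centerFree_of_isSlimGroup {K Ω : Type*} [Field K] [Field Ω] [Algebra K Ω]
    (M : IntermediateField K Ω) (hslim : IsSlimGroup (Ω ≃ₐ[K] Ω))
    (hopen : IsOpen (M.fixingSubgroup : Set (Ω ≃ₐ[K] Ω))) : CenterFree K Ω M :=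
  centerFree_of_centralizer_eq_bot M (hslim.centralizer_eq_bot _ hopen)

/-- **F-1392, INSTANCE FORM (number fields), PROVED**: for a number field `K`, `Ω = K̄` and a finite
subextension `M`, `Gal(K̄/M)` is center-free — by the tree's unconditional slimness of `G_K`
(`galoisNF_slim_holds`, [AbsAnab] Thm 1.1.1 (ii)) and openness of `Gal(K̄/M)` (Krull topology).
[cite: MochizukiAbsAnab2004, Thm 1.1.1 (ii) p.6] -/
theorem centerFree_numberField (K : Type) [Field K] [NumberField K]
    (M : IntermediateField K (AlgebraicClosure K)) [FiniteDimensional K M] :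
    CenterFree K (AlgebraicClosure K) M :=
  centerFree_of_isSlimGroup M (galoisNF_slim_holds K) M.fixingSubgroup_isOpen

/-- **F-1392, INSTANCE FORM (number fields, `M = K`)**: the absolute Galois group `Gal(K̄/K) = Fix(⊥)` of a
number field is center-free. [cite: MochizukiAbsAnab2004, Thm 1.1.1 (ii) p.6] -/
theorem centerFree_numberField_bot (K : Type) [Field K] [NumberField K] :
    CenterFree K (AlgebraicClosure K) ⊥ :=
  centerFree_numberField K ⊥

/-- **F-1392, INSTANCE FORM (mixed-characteristic local fields), PROVED**: for `K` finite over `ℚ_p`,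
`Ω = K̄` and a finite subextension `M`, `Gal(K̄/M)` is center-free — by the tree's unconditional
`galoisMLF_slim_holds` ([AbsAnab] Thm 1.1.1 (ii), local half). [cite: MochizukiAbsAnab2004, Thm 1.1.1 (ii) p.6] -/
theorem centerFree_mlf (p : ℕ) [Fact p.Prime] (K : Type) [Field K] [Algebra ℚ_[p] K]
    [FiniteDimensional ℚ_[p] K] (M : IntermediateField K (AlgebraicClosure K)) [FiniteDimensional K M] :
    CenterFree K (AlgebraicClosure K) M :=
  centerFree_of_isSlimGroup M (galoisMLF_slim_holds p K) M.fixingSubgroup_isOpen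

end KappaSol

/-! ## F-1314 `NearlyAbsolutelyPrimitive` ([IUTchI] Rmk 3.2.2 p. 74) at `p`-adic Frobenioid data -/

section NearlyAbsolutelyPrimitive

variable {D : Type u} [Category.{v} D] {p : ℕ} [Fact p.Prime]

/-- The fact-list predicate READ AT a `p`-adic Frobenioid datum `d` ([FrdII] Ex. 1.1 (ii)): with
`Φ A :=` the image of `Φ(A)` in `Φ₀(A)^gp` and `R A := ℤ·ord(ℚ_p^×)`, `NearlyAbsolutelyPrimitive Φ R` says
exactly «there is ONE positive `N` with `N·Φ(A) ⊆ ℤ·ord(ℚ_p^×)` for every object `A`», i.e. `N·Φ` is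
absolutely primitive. [cite: MochizukiFrdII2008, Ex 1.1 (ii) p.8] -/
theorem nearlyAbsolutelyPrimitive_padicDatum_iff (d : PadicFrd.Datum D p) :
    NearlyAbsolutelyPrimitive (Obj := D) (fun A => MonoidHom.mrange (d.phiGp A))
        (fun A => (d.ordQpSubgroup A).toSubmonoid) ↔
      ∃ N : ℕ, 0 < N ∧ ∀ (A : D) (x : d.Φ.obj (op A)), d.phiGp A x ^ N ∈ d.ordQpSubgroup A := by
  constructor
  · rintro ⟨N, hN, h⟩
    exact ⟨N, hN, fun A x => h A _ ⟨x, rfl⟩⟩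
  · rintro ⟨N, hN, h⟩
    refine ⟨N, hN, fun A y hy => ?_⟩
    obtain ⟨x, rfl⟩ := hy
    exact h A x

/-- An absolutely primitive datum (`Φ(A) ⊆ ℤ·ord(ℚ_p^×)`, [FrdII] Ex. 1.1 (ii)) is nearly absolutely
primitive with `N = 1`. [cite: MochizukiFrdII2008, Ex 1.1 (ii) p.8] -/
theorem nearlyAbsolutelyPrimitive_of_isAbsolutelyPrimitive (d : PadicFrd.Datum D p)
    (h : d.IsAbsolutelyPrimitive) :
    NearlyAbsolutelyPrimitive (Obj := D) (fun A => MonoidHom.mrange (d.phiGp A))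
      (fun A => (d.ordQpSubgroup A).toSubmonoid) :=
  (nearlyAbsolutelyPrimitive_padicDatum_iff d).mpr
    ⟨1, Nat.one_pos, fun A x => by
      rw [pow_one]
      have hx := h A x
      exact hx⟩

/-- Nearly absolutely primitive ⇒ absolutely primitive for `Λ = ℚ`: every `Div(x)`, `x ∈ Φ(A)`, lies in
`ℚ·ord(ℚ_p^×)` (`lambdaSpan .Q`). [cite: MochizukiFrdII2008, Ex 1.1 (ii) p.8] -/
theorem mem_lambdaSpanQ_of_nearlyAbsolutelyPrimitive (d : PadicFrd.Datum D p)
    (h : NearlyAbsolutelyPrimitive (Obj := D) (fun A => MonoidHom.mrange (d.phiGp A))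
      (fun A => (d.ordQpSubgroup A).toSubmonoid))
    (A : D) (x : d.Φ.obj (op A)) : d.phiGp A x ∈ PadicFrd.Datum.lambdaSpan .Q (d.ordQpSubgroup A) := by
  obtain ⟨N, hN, hN'⟩ := (nearlyAbsolutelyPrimitive_padicDatum_iff d).mp h
  change ∃ n : ℕ, 0 < n ∧ d.phiGp A x ^ n ∈ d.ordQpSubgroup A
  exact ⟨N, hN, hN' A x⟩

/-- **Good place** ([IUTchI] Ex. 3.3 (i), `Φ_{C_v^⊢} : Spec L ↦ ord(ℤ_{p_v}^⊳)`, i.e. `c = p`): the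
absolutely primitive datum `Datum.prim` is nearly absolutely primitive (`N = 1`).
[cite: MochizukiFrdII2008, Ex 1.1 (ii) p.8] -/
theorem nearlyAbsolutelyPrimitive_prim (base : D ⥤ PadicFrd.PadicFld.{u} p)
    (hloc : ∀ A : D, (base.obj A).IsPadicLocal) (hc : IsConnected D) (he : IsTotallyEpimorphic D) :
    NearlyAbsolutelyPrimitive (Obj := D) (fun A => MonoidHom.mrange ((PadicFrd.Datum.prim base hloc hc he).phiGp A))
      (fun A => ((PadicFrd.Datum.prim base hloc hc he).ordQpSubgroup A).toSubmonoid) :=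
  nearlyAbsolutelyPrimitive_of_isAbsolutelyPrimitive _ (PadicFrd.Datum.prim_isAbsolutelyPrimitive base hloc hc he)

/-- **F-1314, INSTANCE FORM AT THE INTENDED MODEL, PROVED** ([IUTchI] Rmk 3.2.2: «there exists a positive
integer `N` such that `N·Φ_{C⊢_v}` is absolutely primitive», «as is easily verified»): for the monogenic
`p_v`-adic Frobenioid datum `C_v^⊢` of the tree — `Φ_{C_v^⊢} = ℕ·log(q′)` generated by the images of a
non-unit `q′ ∈ O_{K_v}^⊳` over a `K_v`-relative base of `p`-adic local fields (`PadicFrd.BadLocalKit.datum`)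
— ONE positive `N` satisfies `N·Φ_{C_v^⊢}(A) ⊆ ℤ·ord(ℚ_p^×)` at EVERY object `A`.  Proof: in the `p`-adic
field of one object `A₀`, `v(q′)^n = v(p)^m` with `0 < n` (`≤ [K_{A₀} : ℚ_p]`) and `m ≥ 1`; this identity of
classes in `ord(O^⊳)` descends to `K_v` along the valuative embedding `K_v → K_{A₀}` (injective on `ord`)
and is then transported to every `K_A`. [cite: Mochizuki2012, IUTchI Rmk 3.2.2 p.74] -/
theorem nearlyAbsolutelyPrimitive_badLocalKit {base : D ⥤ PadicFrd.PadicFld.{u} p} {Kv : Type u}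
    [Field Kv] [ValuativeRel Kv] (E : PadicFrd.RelEmb base Kv)
    (hloc : ∀ A : D, (base.obj A).IsPadicLocal) (hc : IsConnected D) (he : IsTotallyEpimorphic D)
    {q' : PadicFrd.intNonzero Kv} (hq' : ¬ IsUnit q') :
    NearlyAbsolutelyPrimitive (Obj := D)
      (fun A => MonoidHom.mrange ((PadicFrd.BadLocalKit.datum E hloc hc he hq').phiGp A))
      (fun A => ((PadicFrd.BadLocalKit.datum E hloc hc he hq').ordQpSubgroup A).toSubmonoid) := by
  rw [nearlyAbsolutelyPrimitive_padicDatum_iff]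
  -- one object of the (connected, hence nonempty) base
  obtain ⟨A₀⟩ := hc.is_nonempty
  obtain ⟨⟨inst, hfin, hcomp⟩⟩ := hloc A₀
  letI := inst
  haveI := hfin
  -- arithmetic in `K_{A₀}`: `v(q′)^n = v(p)^k`
  have hx0 : (E.emb A₀ (q' : Kv)) ≠ 0 := (E.img q' A₀).2.2
  obtain ⟨n, hn, -, k, hk⟩ := PadicFrd.exists_pow_valuation_eq_zpow_le hcomp hx0
  have hlt : valuation (base.obj A₀).K (E.emb A₀ (q' : Kv)) < 1 :=
    PadicFrd.Monogenic.IsConstantSection.valuation_lt_one base (E.isConstantSection hq') A₀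
  have hvp0 : valuation (base.obj A₀).K ((p : ℕ) : (base.obj A₀).K) ≠ 0 :=
    (Valuation.ne_zero_iff _).mpr (base.obj A₀).p_mem.2
  have hvp1 : valuation (base.obj A₀).K ((p : ℕ) : (base.obj A₀).K) ≤ 1 := (base.obj A₀).p_mem.1
  -- `k = m ≥ 0`
  obtain ⟨m, hm⟩ : ∃ m : ℕ, k = m := by
    rcases Int.eq_nat_or_neg k with ⟨m, hkm | hkm⟩
    · exact ⟨m, hkm⟩
    · exfalso
      have h1 : valuation (base.obj A₀).K (E.emb A₀ (q' : Kv)) ^ n < 1 := pow_lt_one₀ zero_le hlt hn.ne'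
      rw [hk, hkm, zpow_neg, zpow_natCast] at h1
      have h2 : valuation (base.obj A₀).K ((p : ℕ) : (base.obj A₀).K) ^ m ≤ 1 := pow_le_one₀ zero_le hvp1
      have h3 : (1 : ValueGroupWithZero (base.obj A₀).K) ≤
          (valuation (base.obj A₀).K ((p : ℕ) : (base.obj A₀).K) ^ m)⁻¹ :=
        (one_le_inv₀ (pow_pos (zero_lt_iff.mpr hvp0) _)).mpr h2
      exact absurd h1 (not_lt.mpr h3)
  -- the identity of classes in `ord(O_{K_{A₀}}^⊳)`
  have hval : valuation (base.obj A₀).K ((E.img q' A₀ ^ n : PadicFrd.intNonzero (base.obj A₀).K) : (base.obj A₀).K) =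
      valuation (base.obj A₀).K
        ((PadicFrd.Monogenic.pSection base A₀ ^ m : PadicFrd.intNonzero (base.obj A₀).K) : (base.obj A₀).K) := by
    rw [SubmonoidClass.coe_pow, SubmonoidClass.coe_pow, map_pow, map_pow, PadicFrd.RelEmb.coe_img, hk, hm, zpow_natCast]
    rfl
  have hA₀ : Associates.mk (E.img q' A₀) ^ n = Associates.mk (PadicFrd.Monogenic.pSection base A₀) ^ m := by
    rw [← Associates.mk_pow, ← Associates.mk_pow]
    exact (PadicFrd.associatesMk_eq_iff_valuation_eq _ _).mpr hval
  -- `p` as an element of `O_{K_v}^⊳`, and its images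
  have hp1 : valuation Kv ((p : ℕ) : Kv) ≤ 1 := by
    have h : (E.emb A₀) ((p : ℕ) : Kv) ≤ᵥ (E.emb A₀) 1 := by
      rw [map_natCast, map_one, (valuation (base.obj A₀).K).vle_iff_le, map_one]
      exact hvp1
    have h2 := (E.isValHom A₀ _ _).mp h
    rw [(valuation Kv).vle_iff_le, map_one] at h2
    exact h2
  have hp0 : ((p : ℕ) : Kv) ≠ 0 := fun h =>
    (base.obj A₀).p_mem.2 (by rw [← map_natCast (E.emb A₀) p, h, map_zero])
  set pv : PadicFrd.intNonzero Kv := ⟨((p : ℕ) : Kv), hp1, hp0⟩ with hpv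
  have himg : ∀ A : D, PadicFrd.intNonzeroMapOfHom (E.emb A) (E.isValHom A) pv =
      PadicFrd.Monogenic.pSection base A := fun A =>
    Subtype.ext (by
      rw [PadicFrd.coe_intNonzeroMapOfHom]
      exact map_natCast (E.emb A) p)
  -- descend to `K_v` …
  have hv : Associates.mk q' ^ n = Associates.mk pv ^ m := by
    apply PadicFrd.ordIntMapOfHom_injective (E.emb A₀) (E.isValHom A₀)
    rw [map_pow, map_pow, PadicFrd.ordIntMapOfHom_mk, PadicFrd.ordIntMapOfHom_mk, himg A₀]
    exact hA₀
  -- … and transport to every fibre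
  have hA : ∀ A : D, Associates.mk (E.img q' A) ^ n = Associates.mk (PadicFrd.Monogenic.pSection base A) ^ m :=
    fun A => by
      have h := congrArg (PadicFrd.ordIntMapOfHom (E.emb A) (E.isValHom A)) hv
      rw [map_pow, map_pow, PadicFrd.ordIntMapOfHom_mk, PadicFrd.ordIntMapOfHom_mk, himg A] at h
      exact h
  refine ⟨n, hn, fun A x => ?_⟩
  obtain ⟨_, j, rfl⟩ := x
  refine Subgroup.mem_zpowers_iff.mpr ⟨((m * j : ℕ) : ℤ), ?_⟩
  rw [zpow_natCast]
  change Algebra.GrothendieckGroup.of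
        (Realification.of _ (Associates.mk (PadicFrd.Monogenic.pSection base A))) ^ (m * j) =
      Algebra.GrothendieckGroup.of (Realification.of _ (Associates.mk (E.img q' A)) ^ j) ^ n
  simp only [← map_pow]
  rw [← pow_mul, mul_comm j n, pow_mul, pow_mul, hA A]

end NearlyAbsolutelyPrimitive

/-! ## F-0751 `InjectiveAlongLinear` ([IUTchI] Rmk 3.2.3 (ii) p. 75) at `p`-adic Frobenioid data -/

section InjectiveAlongLinear

variable {D : Type u} [Category.{v} D] {p : ℕ} [Fact p.Prime]

/-- **F-0751, INSTANCE FORM, PROVED** at every `p`-adic Frobenioid datum `d` ([FrdII] Ex. 1.1 (ii)): for the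
model Frobenioid `d.frobenioid` with the BiratUnits model data (linear = Frobenius degree `1`,
`𝒪^×(A^÷) := B(A_D)ˣ`, pull-back = `B(Base φ)` on units), `InjectiveAlongLinear` HOLDS — the pull-backs of
`B = K^× ×_{Φ₀^gp} Φ^gp` are injective (`PadicFrd.Datum.map_B_injective`), discharging the hypothesis of
`S3RemarksLocal.BiratUnits.model_injectiveAlongLinear_of_injective`. [cite: Mochizuki2012, IUTchI Rmk 3.2.3 (ii) p.75] -/
theorem injectiveAlongLinear_padicDatum (d : PadicFrd.Datum D p) :
    InjectiveAlongLinear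
      ({ IsLinear := fun φ => ModelFrobenioid.degFr φ = 1
         units := fun X => (d.B.obj (op X.base))ˣ
         pull := fun φ => Units.map (d.B.map (ModelFrobenioid.baseMap φ).op).hom } :
        S3RemarksLocal.BiratUnits d.frobenioid) :=
  S3RemarksLocal.BiratUnits.model_injectiveAlongLinear_of_injective d.Φ d.B d.divB
    fun f => d.map_B_injective f

/-- **F-0751 at `C_v^⊢`** (the monogenic `p_v`-adic Frobenioid of [IUTchI] Ex. 3.2 (v) in the tree,
`PadicFrd.BadLocalKit.Cdash`). [cite: Mochizuki2012, IUTchI Rmk 3.2.3 (ii) p.75] -/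
theorem injectiveAlongLinear_badLocalKit {base : D ⥤ PadicFrd.PadicFld.{u} p} {Kv : Type u}
    [Field Kv] [ValuativeRel Kv] (E : PadicFrd.RelEmb base Kv)
    (hloc : ∀ A : D, (base.obj A).IsPadicLocal) (hc : IsConnected D) (he : IsTotallyEpimorphic D)
    {q' : PadicFrd.intNonzero Kv} (hq' : ¬ IsUnit q') :
    InjectiveAlongLinear
      ({ IsLinear := fun φ => ModelFrobenioid.degFr φ = 1
         units := fun X => ((PadicFrd.BadLocalKit.datum E hloc hc he hq').B.obj (op X.base))ˣ
         pull := fun φ => Units.map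
           ((PadicFrd.BadLocalKit.datum E hloc hc he hq').B.map (ModelFrobenioid.baseMap φ).op).hom } :
        S3RemarksLocal.BiratUnits (PadicFrd.BadLocalKit.Cdash E hloc hc he hq')) :=
  injectiveAlongLinear_padicDatum _

/-- **F-0751 at the perfection hull** (the `p_v`-adic Frobenioid of `ord(O^⊳)^pf` over the same base,
`PadicFrd.Datum.perf`). [cite: Mochizuki2012, IUTchI Rmk 3.2.3 (ii) p.75] -/
theorem injectiveAlongLinear_perf (base : D ⥤ PadicFrd.PadicFld.{u} p)
    (hloc : ∀ A : D, (base.obj A).IsPadicLocal) (hc : IsConnected D) (he : IsTotallyEpimorphic D) :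
    InjectiveAlongLinear
      ({ IsLinear := fun φ => ModelFrobenioid.degFr φ = 1
         units := fun X => ((PadicFrd.Datum.perf base hloc hc he).B.obj (op X.base))ˣ
         pull := fun φ => Units.map
           ((PadicFrd.Datum.perf base hloc hc he).B.map (ModelFrobenioid.baseMap φ).op).hom } :
        S3RemarksLocal.BiratUnits (PadicFrd.Datum.perf base hloc hc he).frobenioid) :=
  injectiveAlongLinear_padicDatum _

end InjectiveAlongLinear

/-! ## Addendum — F-1391, the decl of record `KappaSolGalois.CenterFree` (`KappaCoricGalois.lean`)

The secondary `KappaSol.CenterFree K Ω M` IS `KappaSolGalois.CenterFree (Gal(Ω/M) ⊆ Gal(Ω/K))` by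
definition (`KappaSol.centerFree_iff`, `KappaSolAgreement.lean`, abc-iut-L3-t8).  Row F-1391 (statement
of record for [IUTchI] Rmk 3.1.7 (iv), seat abc-iut-L5-t2; universal closure REFUTED by
`KappaSolGalois.not_forall_centerFree`) therefore receives the same INSTANCE FORMS, and the mechanism
«slim ⇒ every open subgroup is center-free» is recorded for an arbitrary topological group `Γ`
(seat abc-iut-f-194, float after tranche 194; append-only: the declarations above are unchanged). -/

namespace KappaSolGalois

variable {Γ : Type u} [Group Γ] [TopologicalSpace Γ]

omit [TopologicalSpace Γ] in
/-- A subgroup `G ⊆ Γ` whose centraliser in `Γ` is trivial is center-free in the record sense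
(`KappaSolGalois.CenterFree G`, i.e. `Z(G) = 1`). [cite: Mochizuki2012, IUTchI Rmk 3.1.7 (iv) p.69] -/
theorem centerFree_of_centralizer_eq_bot (G : Subgroup Γ)
    (h : Subgroup.centralizer (G : Set Γ) = ⊥) : CenterFree G := by
  unfold CenterFree
  rw [eq_bot_iff]
  intro σ hσ
  rw [Subgroup.mem_bot]
  have hmem : (σ : Γ) ∈ Subgroup.centralizer (G : Set Γ) := by
    rw [Subgroup.mem_centralizer_iff]
    intro τ hτ
    exact congrArg Subtype.val (Subgroup.mem_center_iff.mp hσ ⟨τ, hτ⟩)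
  rw [h, Subgroup.mem_bot] at hmem
  exact Subtype.ext hmem

/-- **Slim ⇒ open subgroups are center-free** ([FrdI] §0 / [AbsAnab] §0 slimness; the mechanism of the
printed deduction of [IUTchI] Rmk 3.1.7 (iv) p. 69): in a slim topological group `Γ` every OPEN subgroup
`G` satisfies `KappaSolGalois.CenterFree G`. [cite: Mochizuki2012, IUTchI Rmk 3.1.7 (iv) p.69] -/
theorem centerFree_of_isSlimGroup (hslim : IsSlimGroup Γ) (G : Subgroup Γ) (hopen : IsOpen (G : Set Γ)) :
    CenterFree G :=
  centerFree_of_centralizer_eq_bot G (hslim.centralizer_eq_bot G hopen)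

/-- In particular a slim topological group is itself center-free (`G = ⊤`).
[cite: Mochizuki2012, IUTchI Rmk 3.1.7 (iv) p.69] -/
theorem centerFree_top_of_isSlimGroup (hslim : IsSlimGroup Γ) : CenterFree (⊤ : Subgroup Γ) :=
  centerFree_of_isSlimGroup hslim ⊤ (by rw [Subgroup.coe_top]; exact isOpen_univ)

/-- **F-1391, INSTANCE FORM (number fields), PROVED** for the decl of record: `Gal(K̄/M) ⊆ Gal(K̄/K)` is
center-free for `K` a number field and `M` a finite subextension of `K̄ = AlgebraicClosure K` (transfer of
`KappaSol.centerFree_numberField` along `KappaSol.centerFree_iff`; input `galoisNF_slim_holds`).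
[cite: MochizukiAbsAnab2004, Thm 1.1.1 (ii) p.6] -/
theorem centerFree_fixingSubgroup_numberField (K : Type) [Field K] [NumberField K]
    (M : IntermediateField K (AlgebraicClosure K)) [FiniteDimensional K M] :
    CenterFree (M.fixingSubgroup : Subgroup (AlgebraicClosure K ≃ₐ[K] AlgebraicClosure K)) :=
  (KappaSol.centerFree_iff K (AlgebraicClosure K) M).mp (KappaSol.centerFree_numberField K M)

/-- **F-1391, INSTANCE FORM (number fields, the whole group)**: `Gal(K̄/K)` is center-free for `K` a number
field. [cite: MochizukiAbsAnab2004, Thm 1.1.1 (ii) p.6] -/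
theorem centerFree_top_numberField (K : Type) [Field K] [NumberField K] :
    CenterFree (⊤ : Subgroup (AlgebraicClosure K ≃ₐ[K] AlgebraicClosure K)) :=
  centerFree_top_of_isSlimGroup (galoisNF_slim_holds K)

/-- **F-1391, INSTANCE FORM (mixed-characteristic local fields), PROVED** for the decl of record:
`Gal(K̄/M)` is center-free for `K` finite over `ℚ_p` and `M` a finite subextension of `K̄`
(input `galoisMLF_slim_holds`). [cite: MochizukiAbsAnab2004, Thm 1.1.1 (ii) p.6] -/
theorem centerFree_fixingSubgroup_mlf (p : ℕ) [Fact p.Prime] (K : Type) [Field K] [Algebra ℚ_[p] K]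
    [FiniteDimensional ℚ_[p] K] (M : IntermediateField K (AlgebraicClosure K)) [FiniteDimensional K M] :
    CenterFree (M.fixingSubgroup : Subgroup (AlgebraicClosure K ≃ₐ[K] AlgebraicClosure K)) :=
  (KappaSol.centerFree_iff K (AlgebraicClosure K) M).mp (KappaSol.centerFree_mlf p K M)

/-- **F-1391, INSTANCE FORM (MLFs, the whole group)**: `Gal(K̄/K)` is center-free for `K` finite over
`ℚ_p`. [cite: MochizukiAbsAnab2004, Thm 1.1.1 (ii) p.6] -/
theorem centerFree_top_mlf (p : ℕ) [Fact p.Prime] (K : Type) [Field K] [Algebra ℚ_[p] K]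
    [FiniteDimensional ℚ_[p] K] :
    CenterFree (⊤ : Subgroup (AlgebraicClosure K ≃ₐ[K] AlgebraicClosure K)) :=
  centerFree_top_of_isSlimGroup (galoisMLF_slim_holds p K)

end KappaSolGalois

end Literature.IUT.HodgeTheaters

end
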